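import Summits.HubbardSuperconductivity.HubbardSuperconductivity.Theorems.AnisotropyChordStiffnessDoobLoops

/-!
# Route `AnisotropyChord` / H0 rotor rung: CLOSED HOP-WALKS and the one-defect TELEPORT WALK on the Doob configuration
# network (port of theory seat `hubbard-h0-rotor-theory-1`, cycle 10, `Sketch10.lean` Parts I–J, memo ROTOR-THEORY-10
# §141/§143(o); work-order v9 = verbatim port)

* Part I (`ClosedHopWalk`): a closed walk of hop-edges of the configuration network carries the multiplicity function
  `mult`, a circulation (`isCirculation`); drive and resistance are step sums (`drive_eq`, `resistance_eq`); `mult ≤ 1`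
  for an edge-injective walk (`mult_le_one`); average flatness of the amplitude along the walk ⇒
  `a(σ)²·R ≤ 4 n B²` (`sq_mul_resistance_le`) — first half of the stub `hloops` of `windingEnergy_ge_of_simpleLoops`;
* Part J (`ClosedSiteWalk`, `teleportWalk`): one extra defect carried around a closed nearest-neighbour site-walk whose
  sites are free in the background (flippability and the flip relation proved), `teleportWalk_edge_injective`,
  `drive_teleportWalk` (= the net winding displacement), and **`teleportLoop_spec`** = every clause of `hloops` plus
  `π R ≤ M` for one loop — second half of the stub.
Companion: `…StiffnessDoobTeleportFamilies` (Part K: site-congestion ⇒ `hmult`, the typed hypothesis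
`GoodTeleportFamilies`, and N⁻ end to end).  The prover seat's independent special case (simple cycles, background-wise
disjoint families: `DefectCycle` / `GoodStarterFamily`) is `…StiffnessDoobDefectCycles/DefectLoops`.
Typing/proof authority: theory seat `hubbard-h0-rotor-theory-1`, cycle 10.
-/

set_option linter.dupNamespace false

noncomputable section

open Matrix Complex Finset Filter Topology
open scoped ComplexConjugate
open Literature.MathematicalPhysics.QuantumLattice hiding torusPhase torusNorm
open Literature.Probability.LatticeModels
open Summit.HubbardSuperconductivity.HubbardSuperconductivity.Theorems.AnisotropyChord.InsertionEntropy
  (torusPhase norm_torusPhase IsPerronSectorGroundAmplitude)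
open Summit.HubbardSuperconductivity.HubbardSuperconductivity.Theorems.AnisotropyChord.Stiffness

/-! ## I. Closed hop-walks are simple circulations (first half of stub `hloops`)

A CLOSED HOP-WALK of `n` steps (configurations `conf 0, …, conf n = conf 0`, the directed bond flipped at each
step, flippability and the flip relation) defines the edge-multiplicity function `mult` on hop-edges.  We
prove: `mult` is a circulation (`IsCirculation`), `Σ_e f e · mult e = Σ_k f (edge k)` (so drive and resistance
are the step sums), `mult ≤ 1` when the directed hop-edges of the walk are distinct, and `hopCond a > 0` on the
walk when `a > 0` on its configurations. -/

namespace Summit.HubbardSuperconductivity.HubbardSuperconductivity.Theorems.AnisotropyChord.Stiffness.Doob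

variable {L : ℕ} [NeZero L]

/-- A closed walk of `n` single-hop steps in the configuration network. [folklore] -/
structure ClosedHopWalk (L : ℕ) [NeZero L] (n : ℕ) where
  /-- the configurations visited (`conf (Fin.last n) = conf 0`) -/
  conf : Fin (n + 1) → TensorIndex (TorusSite 2 L) 2
  /-- the directed bond `(x, i)` (sites `x`, `x + e_i`) flipped at step `k` -/
  bond : Fin n → TorusSite 2 L × Fin 2
  flip : ∀ k : Fin n, conf k.castSucc (bond k).1 ≠ conf k.castSucc ((bond k).1 + Pi.single (bond k).2 1)
  step : ∀ k : Fin n,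
    conf k.succ = conf k.castSucc ∘ Equiv.swap (bond k).1 ((bond k).1 + Pi.single (bond k).2 1)
  closed : conf (Fin.last n) = conf 0

namespace ClosedHopWalk

variable {n : ℕ} (w : ClosedHopWalk L n)

/-- The `k`-th directed hop-edge of the walk. [folklore] -/
def edge (k : Fin n) : HopEdge L := (w.bond k, w.conf k.castSucc)

/-- Source of the `k`-th hop-edge of a closed hop-walk. [folklore] -/
theorem hopSrc_edge (k : Fin n) : hopSrc (w.edge k) = w.conf k.castSucc := rfl

/-- Target of the `k`-th hop-edge of a closed hop-walk. [folklore] -/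
theorem hopTgt_edge (k : Fin n) : hopTgt (w.edge k) = w.conf k.succ := by
  unfold hopTgt edge; exact (w.step k).symm

/-- Edge multiplicity of the walk. [folklore] -/
def mult (e : HopEdge L) : ℝ := ∑ k : Fin n, if w.edge k = e then (1:ℝ) else 0

/-- The multiplicity function is non-negative. [folklore] -/
theorem mult_nonneg (e : HopEdge L) : 0 ≤ w.mult e := by
  unfold mult; exact sum_nonneg fun k _ => by split_ifs <;> norm_num

/-- `Σ_e f(e)·mult(e) = Σ_k f(edge k)` — sums against the multiplicity are step sums. [folklore] -/
theorem sum_mul_mult (f : HopEdge L → ℝ) : ∑ e, f e * w.mult e = ∑ k : Fin n, f (w.edge k) := by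
  classical
  unfold mult
  simp_rw [mul_sum, mul_ite, mul_one, mul_zero]
  rw [sum_comm]
  refine sum_congr rfl fun k _ => ?_
  rw [Finset.sum_ite_eq]; simp

/-- Shift invariance of step sums on a closed walk: `Σ_k F(conf k) = Σ_k F(conf (k+1))`. [folklore] -/
theorem sum_castSucc_eq_sum_succ (F : TensorIndex (TorusSite 2 L) 2 → ℝ) :
    ∑ k : Fin n, F (w.conf k.castSucc) = ∑ k : Fin n, F (w.conf k.succ) := by
  have h1 := Fin.sum_univ_castSucc (fun k : Fin (n + 1) => F (w.conf k))
  have h2 := Fin.sum_univ_succ (fun k : Fin (n + 1) => F (w.conf k))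
  rw [w.closed] at h1
  linarith

/-- **A closed hop-walk is a circulation.** [folklore] -/
theorem isCirculation : Loop.IsCirculation hopSrc hopTgt w.mult := by
  classical
  refine ⟨w.mult_nonneg, fun v => ?_⟩
  rw [Finset.sum_filter, Finset.sum_filter]
  have hs : ∀ e, (if hopSrc e = v then w.mult e else 0) = (if hopSrc e = v then (1:ℝ) else 0) * w.mult e :=
    fun e => by split_ifs <;> simp
  have ht : ∀ e, (if hopTgt e = v then w.mult e else 0) = (if hopTgt e = v then (1:ℝ) else 0) * w.mult e :=
    fun e => by split_ifs <;> simp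
  simp_rw [hs, ht, w.sum_mul_mult]
  simp_rw [hopSrc_edge, hopTgt_edge]
  exact w.sum_castSucc_eq_sum_succ (fun σ => if σ = v then (1:ℝ) else 0)

/-- Drive of the walk = sum of the step drives. [folklore] -/
theorem drive_eq (s : HopEdge L → ℝ) : Loop.drive s w.mult = ∑ k : Fin n, s (w.edge k) := by
  unfold Loop.drive
  rw [← w.sum_mul_mult s]
  exact sum_congr rfl fun e _ => mul_comm _ _

/-- Resistance of the walk = sum of the step resistances. [folklore] -/
theorem resistance_eq (c : HopEdge L → ℝ) :
    Loop.resistance c w.mult = ∑ k : Fin n, 1 / c (w.edge k) := by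
  unfold Loop.resistance
  rw [← w.sum_mul_mult (fun e => 1 / c e)]
  exact sum_congr rfl fun e _ => by rw [div_eq_mul_one_div, mul_comm]

/-- Distinct directed hop-edges ⇒ multiplicity `≤ 1`. [folklore] -/
theorem mult_le_one (hinj : Function.Injective w.edge) (e : HopEdge L) : w.mult e ≤ 1 := by
  classical
  unfold mult
  by_cases h : ∃ k₀, w.edge k₀ = e
  · obtain ⟨k₀, hk₀⟩ := h
    have hiff : ∀ k, (w.edge k = e ↔ k = k₀) :=
      fun k => ⟨fun hk => hinj (hk.trans hk₀.symm), fun hk => hk ▸ hk₀⟩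
    simp_rw [hiff]
    rw [Finset.sum_ite_eq']; simp
  · push Not at h
    simp [h]

/-- Positive multiplicity means the edge is a step of the walk. [folklore] -/
theorem exists_of_mult_pos {e : HopEdge L} (he : 0 < w.mult e) : ∃ k : Fin n, w.edge k = e := by
  classical
  by_contra h
  push Not at h
  unfold mult at he
  simp [h] at he

/-- The Doob conductance of the `k`-th step is `¼ a(conf k) a(conf (k+1))`. [folklore] -/
theorem hopCond_edge (a : TensorIndex (TorusSite 2 L) 2 → ℝ) (k : Fin n) :
    hopCond a (w.edge k) = (1 / 4 : ℝ) * (a (w.conf k.castSucc) * a (w.conf k.succ)) := by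
  rw [← hopTgt_edge]
  unfold hopCond
  rw [if_pos]
  · rfl
  · exact w.flip k

/-- `a > 0` on the walk ⇒ the walk runs on edges of positive conductance. [folklore] -/
theorem hopCond_pos_of_mult_pos (a : TensorIndex (TorusSite 2 L) 2 → ℝ) (hpos : ∀ k, 0 < a (w.conf k))
    {e : HopEdge L} (he : 0 < w.mult e) : 0 < hopCond a e := by
  obtain ⟨k, rfl⟩ := w.exists_of_mult_pos he
  rw [hopCond_edge]
  exact mul_pos (by norm_num) (mul_pos (hpos _) (hpos _))

/-- Resistance of the walk against the amplitude weight `a(conf 0)²`, under AVERAGE FLATNESS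
`Σ_k (a(conf 0)/a(conf k))² ≤ n B²` along the walk: `a(conf 0)² · R ≤ 4 n B²`. [new: theory seat hubbard-h0-rotor-theory-1, cycle 10, 2026-08-28] -/
theorem sq_mul_resistance_le (a : TensorIndex (TorusSite 2 L) 2 → ℝ) (hpos : ∀ k, 0 < a (w.conf k))
    (B2 : ℝ) (hflat : ∑ k : Fin n, (a (w.conf 0) / a (w.conf k.castSucc)) ^ 2 ≤ n * B2) :
    a (w.conf 0) ^ 2 * Loop.resistance (hopCond a) w.mult ≤ 4 * n * B2 := by
  rw [w.resistance_eq, mul_sum]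
  have hterm : ∀ k : Fin n, a (w.conf 0) ^ 2 * (1 / hopCond a (w.edge k))
      ≤ 2 * ((a (w.conf 0) / a (w.conf k.castSucc)) ^ 2 + (a (w.conf 0) / a (w.conf k.succ)) ^ 2) := by
    intro k
    rw [hopCond_edge]
    have h1 := hpos k.castSucc; have h2 := hpos k.succ
    set A := a (w.conf 0); set p := a (w.conf k.castSucc); set q := a (w.conf k.succ)
    rw [div_pow, div_pow]
    have key : A ^ 2 * (1 / (1 / 4 * (p * q))) = 4 * A ^ 2 / (p * q) := by field_simp
    rw [key, div_add_div _ _ (pow_ne_zero 2 h1.ne') (pow_ne_zero 2 h2.ne'), ← mul_div_assoc,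
      div_le_div_iff₀ (mul_pos h1 h2) (mul_pos (pow_pos h1 2) (pow_pos h2 2))]
    nlinarith [sq_nonneg (p - q), sq_nonneg A, mul_pos h1 h2, sq_nonneg (A * (p - q)),
      mul_nonneg (sq_nonneg A) (sq_nonneg (p - q)), pow_pos h1 2, pow_pos h2 2]
  calc ∑ k : Fin n, a (w.conf 0) ^ 2 * (1 / hopCond a (w.edge k))
      ≤ ∑ k : Fin n, 2 * ((a (w.conf 0) / a (w.conf k.castSucc)) ^ 2 + (a (w.conf 0) / a (w.conf k.succ)) ^ 2) :=
        sum_le_sum fun k _ => hterm k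
    _ = 2 * (∑ k : Fin n, (a (w.conf 0) / a (w.conf k.castSucc)) ^ 2
          + ∑ k : Fin n, (a (w.conf 0) / a (w.conf k.succ)) ^ 2) := by
        rw [← sum_add_distrib, mul_sum]
    _ = 4 * ∑ k : Fin n, (a (w.conf 0) / a (w.conf k.castSucc)) ^ 2 := by
        rw [← w.sum_castSucc_eq_sum_succ (fun σ => (a (w.conf 0) / a σ) ^ 2)]; ring
    _ ≤ 4 * n * B2 := by rw [mul_assoc]; exact mul_le_mul_of_nonneg_left hflat (by norm_num)

end ClosedHopWalk

end Summit.HubbardSuperconductivity.HubbardSuperconductivity.Theorems.AnisotropyChord.Stiffness.Doob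

/-! ## J. The one-defect TELEPORT WALK (second half of stub `hloops`)

A closed SITE-walk `c 0, …, c n = c 0` of unit steps on the torus, all of whose sites are EMPTY in a background
configuration `σ⁻`, lifts to the closed hop-walk `conf k = σ⁻ ∪ {c k}` (one extra particle carried around the
walk).  We construct it (`teleportWalk`), show its directed hop-edges are distinct when the directed site-steps
are, and compute its drive as (minus) the net `j`-displacement of the site-walk.  Together with Part I this
discharges, for ONE loop, every clause of `hloops` in `windingEnergy_ge_of_simpleLoops` plus the bound
`π R ≤ M` from average flatness of the one-defect amplitude profile `k ↦ a(σ⁻ ∪ {c k})`. -/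

namespace Summit.HubbardSuperconductivity.HubbardSuperconductivity.Theorems.AnisotropyChord.Stiffness.Doob

variable {L : ℕ} [NeZero L]

/-- A closed walk of `n` unit steps on the torus `(ℤ/L)²`, with the undirected bond `(lo k, ax k)` of each step
(sites `lo k`, `lo k + e_{ax k}`) recorded. [folklore] -/
structure ClosedSiteWalk (L : ℕ) [NeZero L] (n : ℕ) where
  site : Fin (n + 1) → TorusSite 2 L
  lo : Fin n → TorusSite 2 L
  ax : Fin n → Fin 2
  step : ∀ k : Fin n,
    (site k.castSucc = lo k ∧ site k.succ = lo k + Pi.single (ax k) 1) ∨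
    (site k.castSucc = lo k + Pi.single (ax k) 1 ∧ site k.succ = lo k)
  ne : ∀ k : Fin n, site k.castSucc ≠ site k.succ
  closed : site (Fin.last n) = site 0

namespace ClosedSiteWalk

variable {n : ℕ} (c : ClosedSiteWalk L n)

/-- Signed `j`-displacement of step `k`: `+1` forward along `e_j`, `−1` backward, `0` off-axis. [folklore] -/
def sdisp (j : Fin 2) (k : Fin n) : ℝ :=
  if c.ax k = j then (if c.site k.castSucc = c.lo k then 1 else -1) else 0

/-- Net `j`-displacement of the closed site-walk (`= ± L ×` winding number). [folklore] -/
def disp (j : Fin 2) : ℝ := ∑ k : Fin n, c.sdisp j k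

end ClosedSiteWalk

omit [NeZero L] in
/-- `update σ⁻ v 1 = update σ⁻ u 1 ∘ swap u v` for two distinct empty sites: moving the extra particle from `u`
to `v` is the flip across `{u, v}`. [folklore] -/
theorem update_eq_update_comp_swap (σm : TensorIndex (TorusSite 2 L) 2) {u v : TorusSite 2 L} (huv : u ≠ v)
    (hu : σm u = 0) (hv : σm v = 0) :
    Function.update σm v 1 = Function.update σm u 1 ∘ Equiv.swap u v := by
  funext y
  simp only [Function.comp_apply]
  rcases eq_or_ne y v with rfl | hyv
  · rw [Function.update_self, Equiv.swap_apply_right, Function.update_self]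
  · rw [Function.update_of_ne hyv]
    rcases eq_or_ne y u with rfl | hyu
    · rw [Equiv.swap_apply_left, Function.update_of_ne huv.symm, hu, hv]
    · rw [Equiv.swap_apply_of_ne_of_ne hyu hyv, Function.update_of_ne hyu]

/-- **The teleport walk**: carry one extra particle around an empty closed site-walk. [new: theory seat
hubbard-h0-rotor-theory-1, cycle 10, 2026-08-28] -/
def teleportWalk {n : ℕ} (σm : TensorIndex (TorusSite 2 L) 2) (c : ClosedSiteWalk L n)
    (hempty : ∀ k, σm (c.site k) = 0) : ClosedHopWalk L n where
  conf k := Function.update σm (c.site k) 1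
  bond k := (c.lo k, c.ax k)
  flip k := by
    rcases c.step k with ⟨h1, h2⟩ | ⟨h1, h2⟩
    · simp only
      rw [← h2, ← h1, Function.update_self, Function.update_of_ne (c.ne k).symm, hempty]
      exact one_ne_zero
    · simp only
      rw [← h1, ← h2, Function.update_self, Function.update_of_ne (c.ne k).symm, hempty]
      exact zero_ne_one
  step k := by
    rcases c.step k with ⟨h1, h2⟩ | ⟨h1, h2⟩
    · simp only
      rw [← h2, ← h1]
      exact update_eq_update_comp_swap σm (c.ne k) (hempty _) (hempty _)
    · simp only
      rw [← h1, ← h2, Equiv.swap_comm]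
      exact update_eq_update_comp_swap σm (c.ne k) (hempty _) (hempty _)
  closed := by rw [c.closed]

namespace teleportWalk
-- (no content; lemmas below are stated with explicit arguments)
end teleportWalk

section teleport

variable {n : ℕ} (σm : TensorIndex (TorusSite 2 L) 2) (c : ClosedSiteWalk L n)
  (hempty : ∀ k, σm (c.site k) = 0)

/-- The configurations of the teleport walk. [folklore] -/
theorem teleportWalk_conf (k : Fin (n + 1)) :
    (teleportWalk σm c hempty).conf k = Function.update σm (c.site k) 1 := rfl

/-- The bonds of the teleport walk. [folklore] -/
theorem teleportWalk_bond (k : Fin n) : (teleportWalk σm c hempty).bond k = (c.lo k, c.ax k) := rfl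

/-- The defect position is determined by the configuration. [folklore] -/
theorem site_eq_of_conf_eq {k k' : Fin (n + 1)}
    (h : (teleportWalk σm c hempty).conf k = (teleportWalk σm c hempty).conf k') : c.site k = c.site k' := by
  rw [teleportWalk_conf, teleportWalk_conf] at h
  by_contra hne
  have := congrArg (fun f => f (c.site k)) h
  simp only [Function.update_self, Function.update_of_ne hne, hempty] at this
  exact one_ne_zero this

/-- The two endpoints of a hop differ. [folklore] -/
theorem lo_ne_hi (k : Fin n) : c.lo k ≠ c.lo k + Pi.single (c.ax k) 1 := by
  rcases c.step k with ⟨h1, h2⟩ | ⟨h1, h2⟩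
  · rw [← h2, ← h1]; exact c.ne k
  · rw [← h1, ← h2]; exact (c.ne k).symm

/-- Distinct directed site-steps ⇒ distinct directed hop-edges. [folklore] -/
theorem teleportWalk_edge_injective
    (hsteps : ∀ k k' : Fin n, c.site k.castSucc = c.site k'.castSucc → c.site k.succ = c.site k'.succ → k = k') :
    Function.Injective (teleportWalk σm c hempty).edge := by
  intro k k' h
  unfold ClosedHopWalk.edge at h
  have hb : (c.lo k, c.ax k) = (c.lo k', c.ax k') := congrArg Prod.fst h
  have hc := site_eq_of_conf_eq σm c hempty (congrArg Prod.snd h)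
  refine hsteps k k' hc ?_
  have hlo : c.lo k = c.lo k' := congrArg Prod.fst hb
  have hax : c.ax k = c.ax k' := congrArg Prod.snd hb
  rcases c.step k with ⟨h1, h2⟩ | ⟨h1, h2⟩ <;> rcases c.step k' with ⟨h1', h2'⟩ | ⟨h1', h2'⟩
  · rw [h2, h2', hlo, hax]
  · exfalso; apply lo_ne_hi c k
    exact h1.symm.trans (hc.trans (h1'.trans (by rw [hlo, hax])))
  · exfalso; apply lo_ne_hi c k'
    exact h1'.symm.trans (hc.symm.trans (h1.trans (by rw [hlo, hax])))
  · rw [h2, h2', hlo]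

/-- The step drive of the teleport walk is minus the signed displacement. [folklore] -/
theorem hopDrive_teleportWalk_edge (j : Fin 2) (k : Fin n) :
    hopDrive j ((teleportWalk σm c hempty).edge k) = - c.sdisp j k := by
  unfold hopDrive ClosedHopWalk.edge ClosedSiteWalk.sdisp orient
  simp only [teleportWalk_bond, teleportWalk_conf]
  by_cases hj : c.ax k = j
  · subst hj
    simp only [if_true, one_mul]
    rcases c.step k with ⟨h1, h2⟩ | ⟨h1, h2⟩
    · -- forward: particle at lo k = site k, moves to lo k + e = site (k+1): orient = -1, sdisp = +1
      have hA : Function.update σm (c.site k.castSucc) 1 (c.lo k) = 1 := by rw [← h1, Function.update_self]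
      have hB : Function.update σm (c.site k.castSucc) 1 (c.lo k + Pi.single (c.ax k) 1) = 0 := by
        rw [← h2, Function.update_of_ne (c.ne k).symm, hempty]
      simp only [hA, hB]
      simp [h1]
    · have hA : Function.update σm (c.site k.castSucc) 1 (c.lo k) = 0 := by
        rw [← h2, Function.update_of_ne (c.ne k).symm, hempty]
      have hB : Function.update σm (c.site k.castSucc) 1 (c.lo k + Pi.single (c.ax k) 1) = 1 := by
        rw [← h1, Function.update_self]
      have hne : c.site k.castSucc ≠ c.lo k := by rw [h1]; exact (lo_ne_hi c k).symm
      simp [hA, hB, hne]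
  · simp [hj]

/-- Drive of the teleport walk `= −` net displacement. [folklore] -/
theorem drive_teleportWalk (j : Fin 2) :
    Loop.drive (hopDrive j) (teleportWalk σm c hempty).mult = - c.disp j := by
  rw [ClosedHopWalk.drive_eq, ClosedSiteWalk.disp, ← sum_neg_distrib]
  exact sum_congr rfl fun k _ => hopDrive_teleportWalk_edge σm c hempty j k

/-- **One teleport loop discharges `hloops` and `π R ≤ M`.**  Hypotheses: a once-winding (`disp² = L²`)
closed site-walk of `n ≥ 1` steps with distinct directed steps, empty in `σ⁻`; amplitude positive on the
one-defect configurations and flat on average along the walk (`Σ_k (a(σ)/a(σ⁻ ∪ c_k))² ≤ n B²`, `σ = σ⁻ ∪ c₀`).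
Conclusion: the multiplicity function is a simple winding circulation of positive conductance with
`a(σ)² · R ≤ 4 n B²`. [new: theory seat hubbard-h0-rotor-theory-1, cycle 10, 2026-08-28] -/
theorem teleportLoop_spec (hn : 0 < n) (j : Fin 2)
    (hsteps : ∀ k k' : Fin n, c.site k.castSucc = c.site k'.castSucc → c.site k.succ = c.site k'.succ → k = k')
    (hwind : (L : ℝ) ^ 2 ≤ c.disp j ^ 2)
    (a : TensorIndex (TorusSite 2 L) 2 → ℝ) (hpos : ∀ k, 0 < a (Function.update σm (c.site k) 1))
    (B2 : ℝ) (hflat : ∑ k : Fin n,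
      (a (Function.update σm (c.site 0) 1) / a (Function.update σm (c.site k.castSucc) 1)) ^ 2 ≤ n * B2) :
    let m := (teleportWalk σm c hempty).mult
    (Loop.IsCirculation hopSrc hopTgt m ∧ (∀ e, 0 < m e → 0 < hopCond a e) ∧ (∀ e, m e ≤ 1) ∧
      (L : ℝ) ^ 2 ≤ Loop.drive (hopDrive j) m ^ 2 ∧ 0 < Loop.resistance (hopCond a) m) ∧
    a (Function.update σm (c.site 0) 1) ^ 2 * Loop.resistance (hopCond a) m ≤ 4 * n * B2 := by
  set w := teleportWalk σm c hempty with hw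
  have hposw : ∀ k, 0 < a (w.conf k) := fun k => hpos k
  refine ⟨⟨w.isCirculation, fun e he => w.hopCond_pos_of_mult_pos a hposw he,
    w.mult_le_one (teleportWalk_edge_injective σm c hempty hsteps), ?_, ?_⟩, ?_⟩
  · rw [drive_teleportWalk, neg_sq]; exact hwind
  · rw [w.resistance_eq]
    refine sum_pos (fun k _ => ?_) ?_
    · rw [w.hopCond_edge]; exact div_pos one_pos (mul_pos (by norm_num) (mul_pos (hposw _) (hposw _)))
    · rw [Finset.univ_nonempty_iff]; exact ⟨⟨0, hn⟩⟩
  · exact w.sq_mul_resistance_le a hposw B2 hflat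

end teleport

end Summit.HubbardSuperconductivity.HubbardSuperconductivity.Theorems.AnisotropyChord.Stiffness.Doob

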